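import Summits.QuantumFields.QCD.Theses.CentreStabilisedCircle
import Summits.QuantumFields.QCD.Theorems.NestedDissectionSeaThresholdShift

/-!
# `OffsetToFull` (stmt-QuantumFields-9529) — the threshold shift reaching `FullLatticeGap`

Route CentreStabilisedCircle, support item `OffsetToFull`: the THRESHOLD form of the lattice half delivered
by the chain SmallCircleGap → CircleContinuity → SlabToTorus —

  for `N_f ∈ {2, 3}` some mass-independent regularisation `reg` with `HasMassScaling` and two-loop
  `HasAsymptoticScaling` and some `M₀ ≥ 0` such that for all mass tuples `m > M₀` (componentwise) the bare
  masses are eventually on the physical branch and `(reg.scheme m 0 0).HasLatticeMassGap Δ` for some `Δ > 0`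

— implies the ALL-POSITIVE-MASSES form `FullLatticeGap` (same clause for all `m > 0`).

Proof (audit g7's threshold re-basing; Montvay–Münster §5.1: the additive Wilson mass renormalisation is
flavour-blind): replace the critical bare mass `m_crit(k)` by `m_crit(k) + a_k M₀ / Z_m(k)`. The tree lemma
`Summit.QuantumFields.QCD.Theorems.thresholdShift_generic` supplies the re-based regularisation `reg'` with
`reg.HasMassScaling → reg'.HasMassScaling` and `reg'.scheme m z shift = reg.scheme (m + M₀) z shift`; the
asymptotic-scaling clause reads only the spacings `a` and couplings `β`, which `scheme` copies from the
regularisation independently of the masses, so it transports along the same identity. For `m > 0`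
componentwise, `m + M₀ > M₀`, and the threshold clause at `m + M₀` is literally the wanted clause at `m`.

* `offsetToFull_proof` — the route decl `CentreStabilisedCircle.OffsetToFull`, literally.
-/

namespace Summit.QuantumFields.QCD.Theorems

open Literature.MathematicalPhysics.QuantumFieldTheory

/-- **`OffsetToFull` holds** (item stmt-QuantumFields-9529 of route CentreStabilisedCircle, literally the
route decl): the threshold form (`∃ reg` with mass scaling and asymptotic scaling, `∃ M₀ ≥ 0`, `∀ m > M₀`:
physical branch ∧ `∃ Δ > 0, HasLatticeMassGap Δ`) implies the all-positive-masses form `FullLatticeGap`.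
Re-base `m_crit(k) ↦ m_crit(k) + a_k M₀ / Z_m(k)` (`thresholdShift_generic`): the new regularisation keeps
`a, β, L, Z_m` — hence mass scaling and asymptotic scaling — and its scheme at `m` is the old scheme at
`m + M₀ > M₀`. [folklore; cf. MontvayMunster1994 §5.1] -/
theorem offsetToFull_proof : Summit.QuantumFields.QCD.Theses.CentreStabilisedCircle.OffsetToFull := by
  unfold Summit.QuantumFields.QCD.Theses.CentreStabilisedCircle.OffsetToFull
  intro h Nf hNf
  obtain ⟨reg, hMS, hAS, M₀, hM₀, hm⟩ := h Nf hNf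
  obtain ⟨reg', hMS', hsch⟩ := thresholdShift_generic Nf reg M₀
  refine ⟨reg', hMS' hMS, ?_, fun m hpos => ?_⟩
  · -- asymptotic scaling reads only `a` and `β`, shared by every scheme of `reg`
    rw [hsch]
    exact hAS
  · have hgt : ∀ f, M₀ < m f + M₀ := fun f => by linarith [hpos f]
    obtain ⟨hbr, Δ, hΔ, hgap⟩ := hm (fun f => m f + M₀) hgt
    refine ⟨fun f => ?_, Δ, hΔ, ?_⟩
    · rw [hsch]
      exact hbr f
    · rw [hsch]
      exact hgap

end Summit.QuantumFields.QCD.Theorems
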